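import Summits.HubbardSuperconductivity.HubbardLadder.Bounds.ThermalAttractiveStiffnessCeilingSharp
import Summits.HubbardSuperconductivity.HubbardLadder.Bounds.StiffnessCeilingSharpInstances
import HarnessLib

/-!
# Hubbard ladder — Bounds: the TIGHT Mott-window ceilings at `T > 0` with ONE entropy term
# (bounds.tex Thm 7♯ at `T > 0`: kinetic and stiffness form, half-filled repulsive torus, typed AND proved)

HONEST FRAMING (cell pub-hubbard): ladder R1–R4 with certified numbers; no claim on H/H₀. These
are bounds for a MODEL CLASS — the repulsive Hubbard torus `hubbardTorusTT' L 1 0 U`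
(`= hubbardTorus 2 L 1 U`; `t = 1`, `t' = 0`, `U > 0`, torus `(ℤ/Lℤ)²`, `L ≥ 4` even) in the
canonical HALF-FILLED `(L², S^z = 0)` Gibbs state at `β > 0`, for a stiffness DEFINED from the
flux response of the sector free energy; no materials claim. Companion text:
`pub-hubbard/paper/bounds.tex` §Theorem 7♯ and Corollary 11.1; tables
`pub-hubbard/pub-hubbard-bounds/BOUNDS.md` (rows T5♯, T9) and `EXTREMISERS.md` §5.

## What is proved (no `sorry`, no new axioms), `N_p := dim` of the sector

* `groundEnergy_toBlock_le_groundEnergyAt_of_sector` — the compression of `hubbardTorusTT' L 1 0 U`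
  to any coordinate sector `p` containing Lieb's `(m↑, m↓)` configurations has ground energy
  `≤ E_L(U; 2m)` (a unit sector ground state, `NoGo.exists_unit_groundStateInSector_hubbardTorus`,
  Lieb's `E(2m) = E(2m, S^z = 0)` as `sectorEnergy_two_mul_eq_groundEnergyAt`, restricted to the
  block).
* `kin_le_of_mott_brackets_arith` — the thermal tight chord: `L₁ ≤ -k + U₁ d` and
  `-k + U d ≤ R + ℓ` with `0 ≤ U₁ < U` give `k ≤ (U₁ R - U L₁)/(U - U₁) + (U₁/(U - U₁)) ℓ`.
* `neg_re_gibbsState_hopping_le_mott_sharp` — **Thm 7♯(v) at `T > 0`, tree form** (`L ≥ 4` even —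
  stated as `Even L`, `3 ≤ L` —, `0 ≤ U₁ < U`, `Δ ≠ 0`, `β > 0`, `p ⊆ {|s| = L²}` containing every
  `(L²/2 ↑, L²/2 ↓)` configuration):
  `⟨-T⟩_{β,p} = -Re⟨H(0)|_p⟩_{β,p} ≤ L² (U₁ sdwClosed U Δ - U lmClosed U₁)/(U - U₁) + (U₁/(U - U₁)) (log N_p)/β`.
  Proof = the tight chord of Thm 3♯/7♯ with the all-`N` Langer–Mattis floor at `U₁`
  (`hubbardTorus_groundEnergyAt_sq_ge_lmClosed`) tested on the Gibbs state as a BLOCK OPERATOR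
  inequality (`le_re_gibbsState_toBlock_of_le_groundEnergy`), and the thermal upper bracket
  `Re⟨H(U)⟩_β ≤ E₀(H(U)|_p) + (log N_p)/β ≤ L² sdwClosed U Δ + (log N_p)/β`
  (`re_gibbsState_self_le_groundEnergy_add`, the SDW Hartree–Fock bound
  `hubbardTorus_groundEnergyAt_le_sdwClosed` through the block lemma above). The ENERGY chord pays
  the entropy ONCE and with the coefficient `U₁/(U - U₁)` (`= 1` at `U₁ = U/2`); the free-energy
  chord of bounds.tex Cor. 11.1(i) (first version) paid `U/(U - U₁)` (`= 2`).
* `thermalStiffness_mul_sq_le_mott_sharp` — **Thm 7♯(ii) at `T > 0`**: if the half-filled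
  `(L², S^z = 0)` sector free energy of `hubbardTorusTT'Flux L 0 U θ` is stiff in the flux,
  `β ρ_s θ² ≤ log Z_p(0) - log Z_p(θ)` on `|θ| ≤ θ₀`, then `ρ_s L²` is at most ONE QUARTER of the
  kinetic ceiling (thermal f-sum floor `thermalStiffnessTT'_mul_sq_le_kinetic`, rotation averaging
  `two_mul_re_gibbsState_kinOpTT'_le`).
* `ThermalMottKineticCeilingSharp` / `…_holds`, `ThermalMottStiffnessCeilingSharp` / `…_holds` —
  the displays as nodes; `ThermalMottStiffnessCeilingU20` / `…_holds` — the kernel-checked decimal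
  instance `U = 20 t`, `U₁ = Δ = 10 t`: `ρ_s L² ≤ 0.307 L² + (log N_p)/(4β)`.

Honest numbers: `log N_p ≤ L² log 4`, so per site at `U₁ = Δ = U/2`:
`⟨-T⟩_β/L² ≤ κ(U) + T log 4`, `ρ_s(T) ≤ κ(U)/4 + (T log 4)/4`,
`κ(U) = 4[(√(256+U²) - U)/16 + U/(16+U²) - 2/√(64+U²)] = 28/U + O(U⁻³)` (`κ(20) = 1.2241`,
`κ(32) = 0.8248`); informative only for `U ≳ 14 t` (where `κ/4 < 4/π²`) and `T ≲ t²/U`. At `T → 0`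
it is the landed Thm 7♯ (`MottStiffnessCeilingSharp`). Fed into the Kubo–Kishi/Falk–Bruch bound of
`Literature/…/HubbardKuboKishiBounds.lean` (bounds.tex Thm 11 (B3)(B4)) it gives the `t/U` decay of
the on-site pair and CDW structure factors at half filling (bounds.tex Cor. 11.1, paper proof).

References (`lean/references.bib`): LangerMattis1971 eqs. (3)–(5) (the floor, closed form as in
`Bounds/MottStiffnessCeiling.lean`); LiebPRL1989 (proof of Thm 1: `S^z = 0` representatives);
ScalapinoWhiteZhang1993 §II; ParamekantiTrivediRanderia1998 eq. (3); HazraVermaRanderia2019 §III,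
App. G; KuboKishi1990 Thms 1–2; Tasaki2020 §2.1.
-/

noncomputable section

namespace Summit.HubbardSuperconductivity.HubbardLadder.Bounds

open Matrix Finset Real
open Literature.MathematicalPhysics.QuantumLattice
open Literature.MathematicalPhysics.QuantumFieldTheory
open Literature.Probability.LatticeModels
open scoped ComplexOrder ComplexConjugate

/-! ### The sector predicate: Lieb's `(m↑, m↓)` configurations lie in the `(2m, S^z = 0)` coordinate sector -/

/-- The number of spin-`0` orbitals of a configuration is the number of its up electrons. -/
theorem card_filter_spin_zero_eq_card_upPart {Λ : Type*} [LinearOrder Λ] [Fintype Λ]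
    (s : Finset (Orb Λ)) : (s.filter fun i => (ofLex i).2 = 0).card = (upPart s).card := by
  rw [show (s.filter fun i => (ofLex i).2 = 0) = (upPart s).image (fun x => orb x 0) from ?_,
    Finset.card_image_of_injective _ (fun x y h => (orb_inj.1 h).1)]
  ext i
  simp only [Finset.mem_filter, Finset.mem_image, mem_upPart]
  constructor
  · rintro ⟨hi, h0⟩
    refine ⟨(ofLex i).1, ?_, ?_⟩ <;>
    · have : orb (ofLex i).1 0 = i := by rw [← h0]; exact toLex_ofLex i
      simp [this, hi]
  · rintro ⟨x, hx, rfl⟩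
    exact ⟨hx, rfl⟩

/-- A configuration with `m` up and `m` down electrons has `2m` orbitals, `m` of them of spin `0`. -/
theorem spinZeroSector_of_card_upPart_downPart {Λ : Type*} [LinearOrder Λ] [Fintype Λ] {m : ℕ}
    {s : Finset (Orb Λ)} (h : (upPart s).card = m ∧ (downPart s).card = m) :
    s.card = 2 * m ∧ 2 * (s.filter fun i => (ofLex i).2 = 0).card = 2 * m := by
  refine ⟨?_, ?_⟩
  · rw [card_eq_upPart_add_downPart, h.1, h.2, two_mul]
  · rw [card_filter_spin_zero_eq_card_upPart, h.1]

variable {L : ℕ} [NeZero L]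

/-- **The compression to a sector containing Lieb's `(m↑, m↓)` configurations has ground energy
`≤ E_L(U; 2m)`** (`m ≤ L²`): a unit ground state of the joint sector `(2m, S^z = 0)` (which realises
`E_L(2m)`, Lieb 1989) is supported in `p`, and its block Rayleigh quotient is its energy. -/
theorem groundEnergy_toBlock_le_groundEnergyAt_of_sector {m : ℕ} (hm : m ≤ L ^ 2) (U : ℝ)
    (p : Finset (Orb (FermionTorus 2 L)) → Prop) [DecidablePred p] [Nonempty {a // p a}]
    (hsec : ∀ s, (upPart s).card = m ∧ (downPart s).card = m → p s) :
    ((hubbardTorusTT' L 1 0 U).toBlock p p).groundEnergy ≤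
      groundEnergyAt (fermionTorusGraph 2 L) 1 U (2 * m) := by
  obtain ⟨ψ, h1, hgs⟩ := NoGo.exists_unit_groundStateInSector_hubbardTorus L 1 U hm
  have hE : (star ψ ⬝ᵥ (hubbardTorusTT' L 1 0 U *ᵥ ψ)).re =
      groundEnergyAt (fermionTorusGraph 2 L) 1 U (2 * m) := by
    rw [hubbardTorusTT'_zero, re_expect_eq_minEnergyOn_of_isGroundStateInSector hgs h1,
      ← sectorEnergy_two_mul_eq_groundEnergyAt U hm]
    rfl
  have hψ0 : ∀ s, ¬ p s → ψ s = 0 := fun s hs =>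
    (mem_szSector_two_mul_zero_iff m ψ).1 hgs.1 s fun h => hs (hsec s h)
  have hHp : ((hubbardTorusTT' L 1 0 U).toBlock p p).IsHermitian :=
    (hubbardTorusTT'_isHermitian L 1 0 U).submatrix _
  have hφ1 : star (fun a : {a // p a} => ψ a.1) ⬝ᵥ (fun a : {a // p a} => ψ a.1) = 1 := by
    rw [star_restrict_dotProduct_restrict p ψ ψ hψ0, h1]
  have h := groundEnergy_le_rayleigh_holds hHp _ hφ1
  rw [star_restrict_dotProduct_toBlock_mulVec p _ ψ hψ0, hE] at h
  exact h

/-- Arithmetic of the thermal tight chord (`0 ≤ U₁ < U`): the floor `L₁ ≤ -k + U₁ d` and the ceiling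
`-k + U d ≤ R + ℓ` give `k ≤ (U₁ R - U L₁)/(U - U₁) + (U₁/(U - U₁)) ℓ`
(`U·floor` and `U₁·ceiling`: the `d`-terms cancel). -/
theorem kin_le_of_mott_brackets_arith {k d U U₁ R L₁ ℓ : ℝ} (hU₁ : 0 ≤ U₁) (hU : U₁ < U)
    (hlow : L₁ ≤ -k + U₁ * d) (hup : -k + U * d ≤ R + ℓ) :
    k ≤ (U₁ * R - U * L₁) / (U - U₁) + U₁ / (U - U₁) * ℓ := by
  have hd : 0 < U - U₁ := sub_pos.2 hU
  have h1 : U₁ * (-k + U * d) ≤ U₁ * (R + ℓ) := mul_le_mul_of_nonneg_left hup hU₁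
  have h2 : U * L₁ ≤ U * (-k + U₁ * d) := mul_le_mul_of_nonneg_left hlow (hU₁.trans hU.le)
  have h3 : (U - U₁) * k ≤ U₁ * R - U * L₁ + U₁ * ℓ := by nlinarith
  have e : (U₁ * R - U * L₁) / (U - U₁) + U₁ / (U - U₁) * ℓ =
      (U₁ * R - U * L₁ + U₁ * ℓ) / (U - U₁) := by
    field_simp
  rw [e, le_div_iff₀ hd, mul_comm]
  exact h3

/-! ### Thm 7♯(v) at `T > 0`: the thermal Mott-window kinetic ceiling -/

/-- **Thm 7♯(v) at `T > 0`, tree form** (`L ≥ 4` even — `Even L`, `3 ≤ L` —, `0 ≤ U₁ < U`, `Δ ≠ 0`,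
`β > 0`, `p` a coordinate sector of `L²`-particle configurations containing every `(L²/2 ↑, L²/2 ↓)`
configuration): `-Re⟨H(0)|_p⟩_{β,p} ≤ L² (U₁ sdwClosed U Δ - U lmClosed U₁)/(U - U₁) +
(U₁/(U - U₁)) (log N_p)/β`. -/
theorem neg_re_gibbsState_hopping_le_mott_sharp (hLe : Even L) (hL : 3 ≤ L) {U U₁ Δ β : ℝ}
    (hU₁ : 0 ≤ U₁) (hU : U₁ < U) (hΔ : Δ ≠ 0) (hβ : 0 < β)
    (p : Finset (Orb (FermionTorus 2 L)) → Prop) [DecidablePred p] [Nonempty {a // p a}]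
    (hpN : ∀ s, p s → s.card = L ^ 2)
    (hsec : ∀ s, (upPart s).card = L ^ 2 / 2 ∧ (downPart s).card = L ^ 2 / 2 → p s) :
    -(gibbsState β ((hubbardTorusTT' L 1 0 U).toBlock p p)
        ((hubbardTorusTT' L 1 0 0).toBlock p p)).re ≤
      (L : ℝ) ^ 2 * ((U₁ * sdwClosed U Δ - U * lmClosed U₁) / (U - U₁)) +
        U₁ / (U - U₁) * (Real.log (Fintype.card {a // p a}) / β) := by
  have hU0 : 0 ≤ U := hU₁.trans hU.le
  have hL2e : 2 * (L ^ 2 / 2) = L ^ 2 :=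
    Nat.two_mul_div_two_of_even (Nat.even_pow.2 ⟨hLe, two_ne_zero⟩)
  have hm : L ^ 2 / 2 ≤ L ^ 2 := Nat.div_le_self _ _
  set D : Matrix (Finset (Orb (FermionTorus 2 L))) (Finset (Orb (FermionTorus 2 L))) ℂ :=
    ∑ x : FermionTorus 2 L, numberOp x 0 * numberOp x 1 with hD
  set H := hubbardTorusTT' L 1 0 U with hH
  set H₀ := hubbardTorusTT' L 1 0 0 with hH₀
  have hHp : (H.toBlock p p).IsHermitian := (hubbardTorusTT'_isHermitian L 1 0 U).submatrix _
  -- operator identities `H = H₀ + U D`, `H(U₁) = H₀ + U₁ D`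
  have hHU : H = H₀ + (U : ℂ) • D := by
    rw [hH, hH₀, hD, hubbardTorusTT'_eq_add_smul_doubleOcc 0 0 U, sub_zero]
  have hH1 : hubbardTorusTT' L 1 0 U₁ = H₀ + (U₁ : ℂ) • D := by
    rw [hH₀, hD, hubbardTorusTT'_eq_add_smul_doubleOcc 0 0 U₁, sub_zero]
  -- the two Gibbs quantities `k = ⟨-T⟩_β`, `d = ⟨D⟩_β`
  set k : ℝ := -(gibbsState β (H.toBlock p p) (H₀.toBlock p p)).re with hk
  have hk' : (gibbsState β (H.toBlock p p) (H₀.toBlock p p)).re = -k := by rw [hk, neg_neg]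
  set d : ℝ := (gibbsState β (H.toBlock p p) (D.toBlock p p)).re with hd
  -- (1) the thermal upper bracket `Re⟨H⟩_β ≤ L² sdwClosed U Δ + (log N_p)/β`
  have hup : -k + U * d ≤ (L : ℝ) ^ 2 * sdwClosed U Δ + Real.log (Fintype.card {a // p a}) / β := by
    have h1 := re_gibbsState_self_le_groundEnergy_add hHp hβ
    have hE0 : (H.toBlock p p).groundEnergy ≤ (L : ℝ) ^ 2 * sdwClosed U Δ := by
      have h := groundEnergy_toBlock_le_groundEnergyAt_of_sector hm U p hsec
      rw [hL2e] at h
      exact h.trans (hubbardTorus_groundEnergyAt_le_sdwClosed hLe hL hU0 hΔ)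
    have hsplit : (gibbsState β (H.toBlock p p) (H.toBlock p p)).re = -k + U * d := by
      have e : H.toBlock p p = H₀.toBlock p p + (U : ℂ) • D.toBlock p p := by
        conv_lhs => rw [hHU]
        ext i j
        rfl
      rw [congrArg (gibbsState β (H.toBlock p p)) e, map_add, map_smul, Complex.add_re, smul_eq_mul,
        Complex.re_ofReal_mul, hk', ← hd]
    linarith
  -- (2) the Langer–Mattis floor at `U₁`, read in the Gibbs state
  have hfl : (L : ℝ) ^ 2 * lmClosed U₁ ≤
      Literature.MathematicalPhysics.QuantumLattice.groundEnergy (hubbardTorusTT' L 1 0 U₁) (L ^ 2) := by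
    rw [hubbardTorusTT'_zero]
    exact hubbardTorus_groundEnergyAt_sq_ge_lmClosed hLe hL U₁
  have hlow : (L : ℝ) ^ 2 * lmClosed U₁ ≤ -k + U₁ * d := by
    -- (`convert` bridges the generic lemma's `ι`-derived decidability instances)
    have hge : (L : ℝ) ^ 2 * lmClosed U₁ ≤
        (gibbsState β (H.toBlock p p) ((hubbardTorusTT' L 1 0 U₁).toBlock p p)).re := by
      convert le_re_gibbsState_toBlock_of_le_groundEnergy
        (hubbardTorusTT'_isHermitian L 1 0 U₁) hfl p hpN hHp β
    have e : (hubbardTorusTT' L 1 0 U₁).toBlock p p = H₀.toBlock p p + (U₁ : ℂ) • D.toBlock p p := by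
      rw [hH1]
      ext i j
      rfl
    rw [e, map_add, map_smul, Complex.add_re, smul_eq_mul, Complex.re_ofReal_mul, hk', ← hd] at hge
    exact hge
  have h := kin_le_of_mott_brackets_arith hU₁ hU hlow hup
  have e : (U₁ * ((L : ℝ) ^ 2 * sdwClosed U Δ) - U * ((L : ℝ) ^ 2 * lmClosed U₁)) / (U - U₁) =
      (L : ℝ) ^ 2 * ((U₁ * sdwClosed U Δ - U * lmClosed U₁) / (U - U₁)) := by ring
  rw [e] at h
  exact h

omit [NeZero L] in
/-- The half-filled `(L², S^z = 0)` coordinate sector of the even torus is non-empty. -/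
theorem nonempty_halfFilledSector (hLe : Even L) :
    Nonempty {s : Finset (Orb (FermionTorus 2 L)) //
      s.card = L ^ 2 ∧ 2 * (s.filter fun i => (ofLex i).2 = 0).card = L ^ 2} := by
  have hL2e : 2 * (L ^ 2 / 2) = L ^ 2 :=
    Nat.two_mul_div_two_of_even (Nat.even_pow.2 ⟨hLe, two_ne_zero⟩)
  rw [← hL2e]
  exact nonempty_spinZeroSector (L := L) (Nat.div_le_self _ _)

omit [NeZero L] in
/-- Lieb's `(L²/2 ↑, L²/2 ↓)` configurations lie in the half-filled `(L², S^z = 0)` coordinate sector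
of the even torus. -/
theorem halfFilledSector_of_card_upPart_downPart (hLe : Even L) (s : Finset (Orb (FermionTorus 2 L)))
    (h : (upPart s).card = L ^ 2 / 2 ∧ (downPart s).card = L ^ 2 / 2) :
    s.card = L ^ 2 ∧ 2 * (s.filter fun i => (ofLex i).2 = 0).card = L ^ 2 := by
  have hL2e : 2 * (L ^ 2 / 2) = L ^ 2 :=
    Nat.two_mul_div_two_of_even (Nat.even_pow.2 ⟨hLe, two_ne_zero⟩)
  have h2 := spinZeroSector_of_card_upPart_downPart h
  rw [hL2e] at h2
  exact h2

/-- **Thm 7♯(v) at `T > 0` (thermal tight Mott-window kinetic ceiling; PROVED below).** `L ≥ 4` even,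
`0 ≤ U₁ < U`, `Δ ≠ 0`, `β > 0`, `p` the half-filled `(L², S^z = 0)` coordinate sector
(`|s| = L²`, `2 · #{i ∈ s : spin i = 0} = L²`), `N_p = dim p = binom(L², L²/2)²`: the sector Gibbs
state of the repulsive Hubbard torus has `⟨-T⟩_{β,p} = -Re⟨H(0)|_p⟩_{β,p} ≤
L² (U₁ sdwClosed U Δ - U lmClosed U₁)/(U - U₁) + (U₁/(U - U₁)) (log N_p)/β`; at `U₁ = Δ = U/2`,
per site: `≤ κ(U) + T log 4`, `κ(U) = 28/U + O(U⁻³)`. kind: support (PROVED). Why it might fail: it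
cannot; informative only for `U ≳ 14 t` and `T ≲ t²/U`. Sources: LangerMattis1971 eqs. (3)–(5);
HazraVermaRanderia2019 §III, App. G; KuboKishi1990 Thm 2; this cell (Thm 3♯, 7♯, Cor. 11.1). -/
@[conjecture] def ThermalMottKineticCeilingSharp : Prop :=
  ∀ (L : ℕ) [NeZero L], Even L → 3 ≤ L → ∀ (U U₁ Δ β : ℝ), 0 ≤ U₁ → U₁ < U → Δ ≠ 0 → 0 < β →
    let p : Finset (Orb (FermionTorus 2 L)) → Prop := fun s =>
      s.card = L ^ 2 ∧ 2 * (s.filter fun i => (ofLex i).2 = 0).card = L ^ 2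
    (-(gibbsState β ((hubbardTorusTT' L 1 0 U).toBlock p p)
        ((hubbardTorusTT' L 1 0 0).toBlock p p)).re) ≤
      (L : ℝ) ^ 2 * ((U₁ * sdwClosed U Δ - U * lmClosed U₁) / (U - U₁)) +
        U₁ / (U - U₁) * (Real.log (Fintype.card {s // p s}) / β)

/-- **`ThermalMottKineticCeilingSharp` holds.** -/
theorem thermalMottKineticCeilingSharp_holds : ThermalMottKineticCeilingSharp := by
  intro L _ hLe hL U U₁ Δ β hU₁ hU hΔ hβ
  dsimp only
  set p : Finset (Orb (FermionTorus 2 L)) → Prop := fun s =>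
    s.card = L ^ 2 ∧ 2 * (s.filter fun i => (ofLex i).2 = 0).card = L ^ 2 with hp
  haveI : Nonempty {a // p a} := nonempty_halfFilledSector (L := L) hLe
  exact neg_re_gibbsState_hopping_le_mott_sharp hLe hL hU₁ hU hΔ hβ p (fun s hs => hs.1)
    (fun s hs => halfFilledSector_of_card_upPart_downPart hLe s hs)

/-! ### Thm 7♯(ii) at `T > 0`: the thermal tight Mott-window stiffness ceiling -/

/-- **Thm 7♯(ii) at `T > 0`** (`L ≥ 4` even, `0 ≤ U₁ < U`, `Δ ≠ 0`, `β, ρ_s, θ₀ > 0`, `p` the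
half-filled `(L², S^z = 0)` coordinate sector, `N_p = dim p`): if the sector free energy of
`hubbardTorusTT'Flux L 0 U θ` is stiff in the flux, `β ρ_s θ² ≤ log Z_p(0) - log Z_p(θ)` on
`|θ| ≤ θ₀`, then `ρ_s L² ≤ [L² (U₁ sdwClosed U Δ - U lmClosed U₁)/(U - U₁) + (U₁/(U - U₁)) (log N_p)/β]/4`. -/
theorem thermalStiffness_mul_sq_le_mott_sharp (hLe : Even L) (hL : 3 ≤ L) {U U₁ Δ β ρs θ₀ : ℝ}
    (hU₁ : 0 ≤ U₁) (hU : U₁ < U) (hΔ : Δ ≠ 0) (hβ : 0 < β) (hρs : 0 < ρs) (hθ₀ : 0 < θ₀)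
    (hstiff : ∀ θ : ℝ, |θ| ≤ θ₀ → β * ρs * θ ^ 2 ≤
      Real.log (partitionFn β ((hubbardTorusTT'Flux L 0 U 0).toBlock
        (fun s : Finset (Orb (FermionTorus 2 L)) =>
          s.card = L ^ 2 ∧ 2 * (s.filter fun i => (ofLex i).2 = 0).card = L ^ 2)
        (fun s => s.card = L ^ 2 ∧ 2 * (s.filter fun i => (ofLex i).2 = 0).card = L ^ 2))).re -
      Real.log (partitionFn β ((hubbardTorusTT'Flux L 0 U θ).toBlock
        (fun s : Finset (Orb (FermionTorus 2 L)) =>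
          s.card = L ^ 2 ∧ 2 * (s.filter fun i => (ofLex i).2 = 0).card = L ^ 2)
        (fun s => s.card = L ^ 2 ∧ 2 * (s.filter fun i => (ofLex i).2 = 0).card = L ^ 2))).re) :
    ρs * (L : ℝ) ^ 2 ≤ ((L : ℝ) ^ 2 * ((U₁ * sdwClosed U Δ - U * lmClosed U₁) / (U - U₁)) +
      U₁ / (U - U₁) * (Real.log (Fintype.card {s : Finset (Orb (FermionTorus 2 L)) //
        s.card = L ^ 2 ∧ 2 * (s.filter fun i => (ofLex i).2 = 0).card = L ^ 2}) / β)) / 4 := by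
  set p : Finset (Orb (FermionTorus 2 L)) → Prop := fun s =>
    s.card = L ^ 2 ∧ 2 * (s.filter fun i => (ofLex i).2 = 0).card = L ^ 2 with hp
  haveI : Nonempty {a // p a} := nonempty_halfFilledSector (L := L) hLe
  have hfloor := thermalStiffnessTT'_mul_sq_le_kinetic hL 0 U hβ hρs hθ₀ p hstiff
  have hrot := two_mul_re_gibbsState_kinOpTT'_le hL 0 U β p
    (fun s t h => sector_iff_of_fockMapOp_rot_ne_zero _ h)
  rw [mul_zero] at hrot
  have hkin := neg_re_gibbsState_hopping_le_mott_sharp hLe hL hU₁ hU hΔ hβ p (fun s hs => hs.1)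
    (fun s hs => halfFilledSector_of_card_upPart_downPart hLe s hs)
  linarith

/-- **Thm 7♯(ii) at `T > 0` (thermal tight Mott-window stiffness ceiling; PROVED below).** `L ≥ 4`
even, `0 ≤ U₁ < U`, `Δ ≠ 0`, `β, ρ_s, θ₀ > 0`, `p` the half-filled `(L², S^z = 0)` coordinate
sector, `N_p = dim p`: if the sector free energy of `hubbardTorusTT'Flux L 0 U θ` (pure Hubbard
torus, `x`-seam twist) is stiff in the flux, `β ρ_s θ² ≤ log Z_p(0) - log Z_p(θ)` on `|θ| ≤ θ₀`,
then `ρ_s L² ≤ [L² (U₁ sdwClosed U Δ - U lmClosed U₁)/(U - U₁) + (U₁/(U - U₁)) (log N_p)/β]/4`,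
i.e. at `U₁ = Δ = U/2`: `ρ_s ≤ κ(U)/4 + T (log N_p)/(4L²) ≤ κ(U)/4 + (T log 4)/4`
(`κ(U)/4 = 7t²/U + O(U⁻³)`; `0.30601` at `U = 20t`, `0.2062` at `U = 32t`). At `T → 0` it is the
landed Thm 7♯ (`MottStiffnessCeilingSharp`). kind: support (PROVED). Why it might fail: it cannot;
informative only for `U ≳ 14 t`, `T ≲ t²/U`. Sources: ScalapinoWhiteZhang1993 §II;
ParamekantiTrivediRanderia1998 eq. (3); HazraVermaRanderia2019 §III, App. G; LangerMattis1971;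
this cell (Thm 3♯, 7♯). -/
@[conjecture] def ThermalMottStiffnessCeilingSharp : Prop :=
  ∀ (L : ℕ) [NeZero L], Even L → 3 ≤ L → ∀ (U U₁ Δ β ρs θ₀ : ℝ), 0 ≤ U₁ → U₁ < U → Δ ≠ 0 →
    0 < β → 0 < ρs → 0 < θ₀ →
    let p : Finset (Orb (FermionTorus 2 L)) → Prop := fun s =>
      s.card = L ^ 2 ∧ 2 * (s.filter fun i => (ofLex i).2 = 0).card = L ^ 2
    (∀ θ : ℝ, |θ| ≤ θ₀ → β * ρs * θ ^ 2 ≤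
        Real.log (partitionFn β ((hubbardTorusTT'Flux L 0 U 0).toBlock p p)).re -
          Real.log (partitionFn β ((hubbardTorusTT'Flux L 0 U θ).toBlock p p)).re) →
    ρs * (L : ℝ) ^ 2 ≤ ((L : ℝ) ^ 2 * ((U₁ * sdwClosed U Δ - U * lmClosed U₁) / (U - U₁)) +
      U₁ / (U - U₁) * (Real.log (Fintype.card {s // p s}) / β)) / 4

/-- **`ThermalMottStiffnessCeilingSharp` holds.** -/
theorem thermalMottStiffnessCeilingSharp_holds : ThermalMottStiffnessCeilingSharp := by
  intro L _ hLe hL U U₁ Δ β ρs θ₀ hU₁ hU hΔ hβ hρs hθ₀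
  dsimp only; intro hst
  exact thermalStiffness_mul_sq_le_mott_sharp hLe hL hU₁ hU hΔ hβ hρs hθ₀ hst

/-! ### Kernel-checked decimal instance (`U = 20 t`, `U₁ = Δ = 10 t`) -/

/-- **`U = 20 t` at `T > 0`: `ρ_s L² ≤ 0.307 L² + (log N_p)/(4β)`** (`≤ (0.307 + 0.3466 T) L²`) for
every flux stiffness of the half-filled `(L², S^z = 0)` sector Gibbs state of every even torus
`L ≥ 4` (`U₁ = Δ = 10`; exact closed-form constant `0.30601`; `T = 0`: `MottStiffnessCeilingU20Sharp`).
kind: support (PROVED). -/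
@[conjecture] def ThermalMottStiffnessCeilingU20 : Prop :=
  ∀ (L : ℕ) [NeZero L], Even L → 3 ≤ L → ∀ (β ρs θ₀ : ℝ), 0 < β → 0 < ρs → 0 < θ₀ →
    let p : Finset (Orb (FermionTorus 2 L)) → Prop := fun s =>
      s.card = L ^ 2 ∧ 2 * (s.filter fun i => (ofLex i).2 = 0).card = L ^ 2
    (∀ θ : ℝ, |θ| ≤ θ₀ → β * ρs * θ ^ 2 ≤
        Real.log (partitionFn β ((hubbardTorusTT'Flux L 0 20 0).toBlock p p)).re -
          Real.log (partitionFn β ((hubbardTorusTT'Flux L 0 20 θ).toBlock p p)).re) →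
    ρs * (L : ℝ) ^ 2 ≤ 0.307 * (L : ℝ) ^ 2 + Real.log (Fintype.card {s // p s}) / (4 * β)

/-- **`ThermalMottStiffnessCeilingU20` holds.** -/
theorem thermalMottStiffnessCeilingU20_holds : ThermalMottStiffnessCeilingU20 := by
  intro L _ hLe hL β ρs θ₀ hβ hρs hθ₀
  dsimp only; intro hst
  have h := thermalStiffness_mul_sq_le_mott_sharp hLe hL (U := 20) (U₁ := 10) (Δ := 10)
    (by norm_num) (by norm_num) (by norm_num) hβ hρs hθ₀ hst
  have hA : (0.37138 : ℝ) ≤ 4 / Real.sqrt (16 + 10 ^ 2) :=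
    four_div_sqrt_ge' (by norm_num) (Real.sqrt_le_iff.2 ⟨by norm_num, by norm_num⟩ :
      Real.sqrt (16 + 10 ^ 2) ≤ 10.7704) (by norm_num) (by norm_num)
  have hB : Real.sqrt (4 + (10 / 4) ^ 2) ≤ 3.2016 := Real.sqrt_le_iff.2 ⟨by norm_num, by norm_num⟩
  have hX := mott_sharp_numeric_20 hA hB
  have hL2 : (0 : ℝ) ≤ (L : ℝ) ^ 2 := by positivity
  have hXL := mul_le_mul_of_nonneg_right hX hL2
  simp only [sdwClosed, lmClosed] at h
  set ℓ := Real.log (Fintype.card {s : Finset (Orb (FermionTorus 2 L)) //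
    s.card = L ^ 2 ∧ 2 * (s.filter fun i => (ofLex i).2 = 0).card = L ^ 2}) with hℓ
  have e : ((L : ℝ) ^ 2 * ((10 * (-(4 / Real.sqrt (16 + 10 ^ 2)) + 20 / (4 + 10 ^ 2)) -
      20 * (10 / 4 - Real.sqrt (4 + (10 / 4) ^ 2))) / (20 - 10)) + 10 / (20 - 10) * (ℓ / β)) / 4 =
      (10 * (-(4 / Real.sqrt (16 + 10 ^ 2)) + 20 / (4 + 10 ^ 2)) -
        20 * (10 / 4 - Real.sqrt (4 + (10 / 4) ^ 2))) / (20 - 10) / 4 * (L : ℝ) ^ 2 +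
      ℓ / (4 * β) := by
    field_simp
    ring
  rw [e] at h
  linarith

end Summit.HubbardSuperconductivity.HubbardLadder.Bounds

end
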